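/-
Copyright (c) 2026 the pub-hodgecm-mathlib formalisation cell (harness21).  Prover seat hodgecm-mathlib-F0P3a-p01 (g35), Track A «(D-RAM) FOUR-FRAME» helper lane
(`--supports stmt-HodgeConjecture-24833 --as helper`); STAGE-1b count-neutral ALGEBRA BRICK (KNOCK 2026-09-04T08:29:56Z offer (r1)).  2026-09-04.
-/
import Summits.HodgeConjecture.HodgeConjecture.Theorems.F0P3cDyRamFourFramePieces       -- ★ DEFS №3 (p854653): `PieceRowsWild`, `gselStar`, the pieces, `InLevel`, `NearTransvShell`, `wMatrix`
import Summits.HodgeConjecture.HodgeConjecture.Theorems.F0P3cDyRamPiecePropsGselStar     -- ★ (LH4-p12 (g0)): `piecePropsWild_gselStar`; brings ★ p854742 `isLocSmooth_indicator_profile`, `uniformizer_facts`, ★ p854732 `inLevel_*`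
import Literature.NumberTheory.Automorphic.OrbitalMeasureCanonical                      -- ★ `OrbitalMeasureFamily.IsCanonical.isAdmissibleOn`
import HarnessLib

/-!
# Crux `H413`, line LH4 «(D-RAM) FOUR-FRAME» — STAGE-1b ALGEBRA BRICK: the three population rows `PieceRowsWild` are LINEAR IN THE PIECE,
# and the tier-0 rows `transvMinus` ∕ `regular` are DERIVED from `transvPlus` ∕ `unit0` and two UNLABELLED congruence-profile pieces

Cell `hodgecm-mathlib` (D-0151), FLOOR 0, crux item H413 = `stmt-HodgeConjecture-24833`, route of record `HCCMUnconditional`; squad F0∕P3c∕LH4; helper lane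
(count-neutral).  THEOREMS ONLY (no `def`, no instance, no notation, no `sorry`, default heartbeats).  Consumer: the STAGE-1b directive (heir LEAD F0P3a-plan ∕ dealer
LH4-plan) for the three open tier-0 rows `F0P3cDyRamFourFrame.stub_rows_transvPlus ∕ _transvMinus ∕ _regular : PieceRowsWild gselStar 1 ∕ 2 ∕ 3` of
`Cruxes/H413/Lines/F0_P3c_DyRamFourFrame.lean` (ED. 3 256fc9e680eaff36).  Nothing here is a `Lines` edition or a registry act; no statement of the line is reworded.

THE MATHEMATICS.  `PieceRowsWild gsel j` (★ №3 §4) asserts, at every wild ramified non-split place and for every `(μ, ν_H, ν_G, m_H, m_G)` with CANONICAL families, ONE finite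
family `ψ_s ∈ C_c^∞(H_v)` with coefficients `a_s` realising the `Δ‴_v[μ]`-weighted class sum `γ_H ↦ Σᶠ_c Δ(γ_H, c)·Φ(c, g)` of the piece `g = gsel j` on each of the three
populations near `1`.  The right-hand side is LINEAR in `g` on `C_c^∞`: the class sum has finite support at a `G`-regular `γ_H` (★ `finite_support_delta_mul_classOrbitalIntegral_of_isLocSmooth`)
and `Φ(c, ·)` is additive at the classes with `Δ ≠ 0` for a family admissible on the regular classes (★ `classOrbitalIntegral_add_of_isLocSmooth_of_delta_ne_zero`; canonical ⇒
admissible, ★ `IsCanonical.isAdmissibleOn`), homogeneous always (★ `orbitalIntegral_smul`); the left-hand side concatenates: `(r₁ + r₂, ψ₁ ⧺ ψ₂, (a·a₁, b·a₂))` (`Fin.append`).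
Hence (§3) `rows(g₁) ∧ rows(g₂) ⇒ rows(a•g₁ + b•g₂)` for smooth pieces, and rows transport along pointwise equality of pieces (§3 `pieceRowsWild_congr`).
The explicit pieces of ★ №3 satisfy the POINTWISE identities (§4, indicator algebra on `rfl`-level sets; `X := wMatrix u − 1`):
`f_{T−} = 𝟙{u ∈ K ∣ NearTransvShell ϖ ℓ₀ m* X} − f_{T+}`, `𝟙{… NearTransvShell ϖ ℓ₀ m* X} = 𝟙{u ∈ K ∣ X ∈ ϖ^{ℓ₀}M₃, X² ∈ ϖ^{m*}M₃} − 𝟙{u ∈ K ∣ X ∈ ϖ^{ℓ₀+1}M₃, X² ∈ ϖ^{m*}M₃}`,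
`f_reg = 1_K − 𝟙{u ∈ K ∣ X² ∈ ϖ^{m*}M₃}` (`ℓ₀ = dOfPlace % 2`, `m* = mstarFn`).  Consequently (§5): `PieceRowsWild gselStar 2 ⇐ PieceRowsWild gselStar 1 ∧ rows(shell)`,
`rows(shell) ⇐ rows(K_{ℓ₀,m*}) ∧ rows(K_{ℓ₀+1,m*})`, `PieceRowsWild gselStar 3 ⇐ PieceRowsWild gselStar 0 ∧ rows(K_{·,m*}²)` where `K_{a,b} := {u ∈ K ∣ X ∈ ϖ^a M₃(𝒪_w), X² ∈ ϖ^b M₃(𝒪_w)}`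
are UNLABELLED congruence-profile sets (unions of `K(ϖ^{m*+2})`-cosets read off `X mod ϖ^{m*+2}`, ★ `isLocSmooth_indicator_profile`) — i.e. the STAGE-1b debt
{`T₊`, `T₋`, `reg`} is {ONE labelled census (`T₊`)} ∪ {rows of three unlabelled profile pieces}, whatever letters the directive cuts; the norm-class LABEL is paid once.

* §1 `pieceRowsWild_iff_const` — `PieceRowsWild gsel j ↔ PieceRowsWild (fun _ : Fin 1 => gsel j) 0` (`Iff.rfl`).
* §2 G-side: `finsum_delta_mul_classOrbitalIntegral_add ∕ _smul ∕ _add_smul` (any `LocalTransferFactor`, canonical-or-admissible `m_G`, `C_c^∞` functions, `G`-regular `γ_H`);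
  H-side: `exists_nhds_rows_append` (generic concatenation of two row clauses).
* §3 `pieceRowsWild_add_smul`, `pieceRowsWild_congr`, `pieceRowsWild_sub`.
* §4 `pieceTransvMinus_eq_shell_sub`, `shell_eq_levels_sub`, `pieceReg_eq_unit0_sub`, `isLocSmooth_levelsPiece`.
* §5 `pieceRowsWild_gselStar_two_of`, `pieceRowsWild_shell_of_levels`, `pieceRowsWild_gselStar_three_of`.
HONEST LABEL.  Count-neutral (`--supports`): no tier-0 row is paid here — each corollary TAKES the rows of the unlabelled pieces (and of `T₊` ∕ `1_K`) as hypotheses;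
`HC_CM` is proved only modulo the 7 printed citations (2 remaining named inputs: hLiu418 = `stmt-HodgeConjecture-24832`, h413 = `stmt-HodgeConjecture-24833`) until rung 0 closes.

## References
* [Rogawski1990] J. D. Rogawski, *Automorphic Representations of Unitary Groups in Three Variables*, Ann. of Math. Stud. 123 (1990): §4.3 (4.3.1) p. 43; §4.9 Prop. 4.9.1 (a) pp. 54–55.
* [LanglandsShelstad1987] R. P. Langlands, D. Shelstad, *On the definition of transfer factors*, Math. Ann. 278 (1987), §1.3–§1.4.
* [Kottwitz1986BaseChangeUnits] R. E. Kottwitz, *Base change for unit elements of Hecke algebras*, Compositio Math. 60 (1986), §1 pp. 240–241, §3.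
-/

set_option autoImplicit false

noncomputable section

namespace Summit.HodgeConjecture.HodgeConjecture.Cruxes.H413.F0P3cDyRamPieceRowsWildLinear

open MeasureTheory Measure NumberField IsDedekindDomain Topology Filter
open Literature.NumberTheory.Automorphic Literature.NumberTheory.Automorphic.UnitaryGroup Literature.NumberTheory.Automorphic.IntegralReduction
open Literature.NumberTheory.Rogawski1990 Literature.NumberTheory.GaloisRepresentations
open Literature.NumberTheory.Automorphic.UnitaryThreeFourFrame
open Literature.MeasureTheory.Group (descConj)
open scoped Matrix MatrixGroups Classical ValuativeRel WithZero
open Summit.HodgeConjecture.HodgeConjecture.Cruxes.H413.F0P3cDyRamFourFramePieces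
open Summit.HodgeConjecture.HodgeConjecture.Cruxes.H413.F0P3cDyRamPiecePropsGselStar
open Summit.HodgeConjecture.HodgeConjecture.Cruxes.H413.F0P3cDyRamProfilePiecesProps
open Summit.HodgeConjecture.HodgeConjecture.Cruxes.H413.F0P3cDyRamProfileLevelClass

/-! ## §1  A row depends on the piece only -/

/-- `PieceRowsWild gsel j` reads the selector only at `j`: it IS the row statement of the one-piece selector `fun _ : Fin 1 => gsel j` (definitional).
[cite: Rogawski1990, §4.9 Prop. 4.9.1 (a) p. 55] -/
theorem pieceRowsWild_iff_const {n : ℕ}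
    (gsel : Fin n → (∀ (L : Type) [Field L] [NumberField L] [IsCMField L] (v : HeightOneSpectrum (𝓞 ↥(maximalRealSubfield L))) (w : UnitaryGroup.PlacesOver L v), IsCMField.complexConj L • w.1 = w.1 → w.1.adicCompletion L → ((UnitaryGroup.cmDatum L 3 (Matrix.of fun i j : Fin 3 => if i.val + j.val + 1 = 3 then (1 : L) else 0)).Local v) → ℂ))
    (j : Fin n) : PieceRowsWild gsel j ↔ PieceRowsWild (fun _ : Fin 1 => gsel j) 0 :=
  Iff.rfl

/-! ## §2  Linearity of the two sides at one place -/

section GSide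

variable (L : Type) [Field L] [NumberField L] [IsCMField L] {v : HeightOneSpectrum (𝓞 ↥(maximalRealSubfield L))}
  [iM : ∀ γ : ((UnitaryGroup.cmDatum L 3 (Matrix.of fun i j : Fin 3 => if i.val + j.val + 1 = 3 then (1 : L) else 0)).Local v), MeasurableSpace (((UnitaryGroup.cmDatum L 3 (Matrix.of fun i j : Fin 3 => if i.val + j.val + 1 = 3 then (1 : L) else 0)).Local v) ⧸ Subgroup.centralizer ({γ} : Set ((UnitaryGroup.cmDatum L 3 (Matrix.of fun i j : Fin 3 => if i.val + j.val + 1 = 3 then (1 : L) else 0)).Local v)))]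
  [iB : ∀ γ : ((UnitaryGroup.cmDatum L 3 (Matrix.of fun i j : Fin 3 => if i.val + j.val + 1 = 3 then (1 : L) else 0)).Local v), BorelSpace (((UnitaryGroup.cmDatum L 3 (Matrix.of fun i j : Fin 3 => if i.val + j.val + 1 = 3 then (1 : L) else 0)).Local v) ⧸ Subgroup.centralizer ({γ} : Set ((UnitaryGroup.cmDatum L 3 (Matrix.of fun i j : Fin 3 => if i.val + j.val + 1 = 3 then (1 : L) else 0)).Local v)))]

omit iB in
/-- **HOMOGENEITY of the `Δ`-weighted class sum**: `Σᶠ_c Δ(γ_H, c)·Φ(c, z • F) = z · Σᶠ_c Δ(γ_H, c)·Φ(c, F)` (any factor, any family, any `F`; Mathlib `mul_finsum` on `ℂ`,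
★ `orbitalIntegral_smul`). [cite: Rogawski1990, §4.3 (4.3.1) p. 43] -/
theorem finsum_delta_mul_classOrbitalIntegral_smul (T : LocalTransferFactor L (Matrix.of fun i j : Fin 3 => if i.val + j.val + 1 = 3 then (1 : L) else 0) v)
    (mG : OrbitalMeasureFamily ((UnitaryGroup.cmDatum L 3 (Matrix.of fun i j : Fin 3 => if i.val + j.val + 1 = 3 then (1 : L) else 0)).Local v))
    (z : ℂ) (F : ((UnitaryGroup.cmDatum L 3 (Matrix.of fun i j : Fin 3 => if i.val + j.val + 1 = 3 then (1 : L) else 0)).Local v) → ℂ)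
    (γH : (UnitaryGroup.cmDatum L 2 (Matrix.of fun i j : Fin 2 => if i.val + j.val + 1 = 2 then (1 : L) else 0)).Local v × (UnitaryGroup.cmDatum L 1 (Matrix.of fun i j : Fin 1 => if i.val + j.val + 1 = 1 then (1 : L) else 0)).Local v) :
    ∑ᶠ c : ConjClasses ((UnitaryGroup.cmDatum L 3 (Matrix.of fun i j : Fin 3 => if i.val + j.val + 1 = 3 then (1 : L) else 0)).Local v), T.Δ γH (Quotient.out c) * classOrbitalIntegral mG (z • F) c =
      z * ∑ᶠ c : ConjClasses ((UnitaryGroup.cmDatum L 3 (Matrix.of fun i j : Fin 3 => if i.val + j.val + 1 = 3 then (1 : L) else 0)).Local v), T.Δ γH (Quotient.out c) * classOrbitalIntegral mG F c := by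
  rw [mul_finsum]
  refine finsum_congr fun c => ?_
  rw [classOrbitalIntegral_eq, classOrbitalIntegral_eq, orbitalIntegral_smul, smul_eq_mul]
  ring

/-- **ADDITIVITY of the `Δ`-weighted class sum on `C_c^∞`** at a `G`-regular `γ_H`, for a family admissible on the regular classes: finite support (★
`finite_support_delta_mul_classOrbitalIntegral_of_isLocSmooth`) and additivity of `Φ(c, ·)` where `Δ ≠ 0` (★ `classOrbitalIntegral_add_of_isLocSmooth_of_delta_ne_zero`).
[cite: Rogawski1990, §4.3 (4.3.1) p. 43; §4.9 p. 54] [cite: LanglandsShelstad1987, §1.3] -/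
theorem finsum_delta_mul_classOrbitalIntegral_add (T : LocalTransferFactor L (Matrix.of fun i j : Fin 3 => if i.val + j.val + 1 = 3 then (1 : L) else 0) v)
    {mG : OrbitalMeasureFamily ((UnitaryGroup.cmDatum L 3 (Matrix.of fun i j : Fin 3 => if i.val + j.val + 1 = 3 then (1 : L) else 0)).Local v)}
    (hmG : mG.IsAdmissibleOn fun γ' => IsRegularElt (γ'.val : GL (Fin 3) (UnitaryGroup.LocalRing L v)))
    (F G : ((UnitaryGroup.cmDatum L 3 (Matrix.of fun i j : Fin 3 => if i.val + j.val + 1 = 3 then (1 : L) else 0)).Local v) → ℂ) (hF : IsLocSmooth F) (hG : IsLocSmooth G)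
    (γH : (UnitaryGroup.cmDatum L 2 (Matrix.of fun i j : Fin 2 => if i.val + j.val + 1 = 2 then (1 : L) else 0)).Local v × (UnitaryGroup.cmDatum L 1 (Matrix.of fun i j : Fin 1 => if i.val + j.val + 1 = 1 then (1 : L) else 0)).Local v)
    (hγ : IsLocalGRegular L v γH) :
    ∑ᶠ c : ConjClasses ((UnitaryGroup.cmDatum L 3 (Matrix.of fun i j : Fin 3 => if i.val + j.val + 1 = 3 then (1 : L) else 0)).Local v), T.Δ γH (Quotient.out c) * classOrbitalIntegral mG (F + G) c =
      ∑ᶠ c : ConjClasses ((UnitaryGroup.cmDatum L 3 (Matrix.of fun i j : Fin 3 => if i.val + j.val + 1 = 3 then (1 : L) else 0)).Local v), T.Δ γH (Quotient.out c) * classOrbitalIntegral mG F c +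
      ∑ᶠ c : ConjClasses ((UnitaryGroup.cmDatum L 3 (Matrix.of fun i j : Fin 3 => if i.val + j.val + 1 = 3 then (1 : L) else 0)).Local v), T.Δ γH (Quotient.out c) * classOrbitalIntegral mG G c := by
  rw [← finsum_add_distrib
    (finite_support_delta_mul_classOrbitalIntegral_of_isLocSmooth L (Matrix.of fun i j : Fin 3 => if i.val + j.val + 1 = 3 then (1 : L) else 0) v
      (UnitaryGroup.antidiagOne_isHermitian L 3) (UnitaryGroup.isUnit_antidiagOne_det L 3).ne_zero T mG F hF γH hγ)
    (finite_support_delta_mul_classOrbitalIntegral_of_isLocSmooth L (Matrix.of fun i j : Fin 3 => if i.val + j.val + 1 = 3 then (1 : L) else 0) v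
      (UnitaryGroup.antidiagOne_isHermitian L 3) (UnitaryGroup.isUnit_antidiagOne_det L 3).ne_zero T mG G hG γH hγ)]
  refine finsum_congr fun c => ?_
  by_cases hΔ : T.Δ γH (Quotient.out c) = 0
  · simp only [hΔ, zero_mul, add_zero]
  · rw [classOrbitalIntegral_add_of_isLocSmooth_of_delta_ne_zero L (Matrix.of fun i j : Fin 3 => if i.val + j.val + 1 = 3 then (1 : L) else 0) v
      (UnitaryGroup.antidiagOne_isHermitian L 3) (UnitaryGroup.isUnit_antidiagOne_det L 3).ne_zero T hmG γH hγ c hΔ F G hF hG, mul_add]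

/-- **LINEARITY of the `Δ`-weighted class sum on `C_c^∞`**: `Σᶠ_c Δ·Φ(c, a•F + b•G) = a·Σᶠ_c Δ·Φ(c, F) + b·Σᶠ_c Δ·Φ(c, G)` at a `G`-regular `γ_H`.
[cite: Rogawski1990, §4.3 (4.3.1) p. 43; §4.9 p. 54] -/
theorem finsum_delta_mul_classOrbitalIntegral_add_smul (T : LocalTransferFactor L (Matrix.of fun i j : Fin 3 => if i.val + j.val + 1 = 3 then (1 : L) else 0) v)
    {mG : OrbitalMeasureFamily ((UnitaryGroup.cmDatum L 3 (Matrix.of fun i j : Fin 3 => if i.val + j.val + 1 = 3 then (1 : L) else 0)).Local v)}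
    (hmG : mG.IsAdmissibleOn fun γ' => IsRegularElt (γ'.val : GL (Fin 3) (UnitaryGroup.LocalRing L v)))
    (a b : ℂ) (F G : ((UnitaryGroup.cmDatum L 3 (Matrix.of fun i j : Fin 3 => if i.val + j.val + 1 = 3 then (1 : L) else 0)).Local v) → ℂ) (hF : IsLocSmooth F) (hG : IsLocSmooth G)
    (γH : (UnitaryGroup.cmDatum L 2 (Matrix.of fun i j : Fin 2 => if i.val + j.val + 1 = 2 then (1 : L) else 0)).Local v × (UnitaryGroup.cmDatum L 1 (Matrix.of fun i j : Fin 1 => if i.val + j.val + 1 = 1 then (1 : L) else 0)).Local v)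
    (hγ : IsLocalGRegular L v γH) :
    ∑ᶠ c : ConjClasses ((UnitaryGroup.cmDatum L 3 (Matrix.of fun i j : Fin 3 => if i.val + j.val + 1 = 3 then (1 : L) else 0)).Local v), T.Δ γH (Quotient.out c) * classOrbitalIntegral mG (a • F + b • G) c =
      a * ∑ᶠ c : ConjClasses ((UnitaryGroup.cmDatum L 3 (Matrix.of fun i j : Fin 3 => if i.val + j.val + 1 = 3 then (1 : L) else 0)).Local v), T.Δ γH (Quotient.out c) * classOrbitalIntegral mG F c +
      b * ∑ᶠ c : ConjClasses ((UnitaryGroup.cmDatum L 3 (Matrix.of fun i j : Fin 3 => if i.val + j.val + 1 = 3 then (1 : L) else 0)).Local v), T.Δ γH (Quotient.out c) * classOrbitalIntegral mG G c := by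
  rw [finsum_delta_mul_classOrbitalIntegral_add L T hmG (a • F) (b • G) (hF.const_smul a) (hG.const_smul b) γH hγ,
    finsum_delta_mul_classOrbitalIntegral_smul L T mG a F γH, finsum_delta_mul_classOrbitalIntegral_smul L T mG b G γH]

end GSide

/-- **CONCATENATION OF TWO ROW CLAUSES** (generic): if near `1` on the population `P`, `R₁ = Σ_s a₁ s · Φ(ψ₁ s)` and `R₂ = Σ_s a₂ s · Φ(ψ₂ s)`, and `R = a·R₁ + b·R₂` at the
regular points, then near `1` on `P`, `R = Σ_s (a•a₁ ⧺ b•a₂) s · Φ((ψ₁ ⧺ ψ₂) s)` (`Fin.append`, `Fin.sum_univ_add`). [cite: Rogawski1990, §4.3 (4.3.1)–(4.3.2) p. 43] -/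
theorem exists_nhds_rows_append {A : Type*} [TopologicalSpace A] [One A] (reg P : A → Prop) (Φ : (A → ℂ) → A → ℂ)
    {r₁ r₂ : ℕ} (ψ₁ : Fin r₁ → A → ℂ) (ψ₂ : Fin r₂ → A → ℂ) (a₁ : Fin r₁ → ℂ) (a₂ : Fin r₂ → ℂ) (a b : ℂ)
    (R R₁ R₂ : A → ℂ) (hlin : ∀ x, reg x → R x = a * R₁ x + b * R₂ x)
    (h₁ : ∃ V ∈ 𝓝 (1 : A), ∀ x ∈ V, reg x → P x → R₁ x = ∑ s, a₁ s * Φ (ψ₁ s) x)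
    (h₂ : ∃ V ∈ 𝓝 (1 : A), ∀ x ∈ V, reg x → P x → R₂ x = ∑ s, a₂ s * Φ (ψ₂ s) x) :
    ∃ V ∈ 𝓝 (1 : A), ∀ x ∈ V, reg x → P x → R x = ∑ s, Fin.append (a • a₁) (b • a₂) s * Φ (Fin.append ψ₁ ψ₂ s) x := by
  obtain ⟨V₁, hV₁, h₁⟩ := h₁
  obtain ⟨V₂, hV₂, h₂⟩ := h₂
  refine ⟨V₁ ∩ V₂, Filter.inter_mem hV₁ hV₂, fun x hx hreg hP => ?_⟩
  rw [hlin x hreg, h₁ x hx.1 hreg hP, h₂ x hx.2 hreg hP, Fin.sum_univ_add]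
  simp only [Fin.append_left, Fin.append_right, Pi.smul_apply, smul_eq_mul, Finset.mul_sum, mul_assoc]

/-! ## §3  Rows are linear in the piece -/

/-- **`PieceRowsWild` IS LINEAR IN THE PIECE**: if the smooth pieces `g₁`, `g₂` have their three population rows at every wild place, so does `a•g₁ + b•g₂` — the `H`-side
families concatenate, the `Δ‴_v[μ]`-weighted class sums are linear on `C_c^∞` for the canonical (hence admissible) family `m_G` (§2).
[cite: Rogawski1990, §4.3 (4.3.1) p. 43; §4.9 Prop. 4.9.1 (a) pp. 54–55] [cite: LanglandsShelstad1987, §1.3] -/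
theorem pieceRowsWild_add_smul
    (g₁ g₂ : (∀ (L : Type) [Field L] [NumberField L] [IsCMField L] (v : HeightOneSpectrum (𝓞 ↥(maximalRealSubfield L))) (w : UnitaryGroup.PlacesOver L v), IsCMField.complexConj L • w.1 = w.1 → w.1.adicCompletion L → ((UnitaryGroup.cmDatum L 3 (Matrix.of fun i j : Fin 3 => if i.val + j.val + 1 = 3 then (1 : L) else 0)).Local v) → ℂ))
    (hs₁ : ∀ (L : Type) [Field L] [NumberField L] [IsCMField L] {v : HeightOneSpectrum (𝓞 ↥(maximalRealSubfield L))} (w : UnitaryGroup.PlacesOver L v)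
      (hw : IsCMField.complexConj L • w.1 = w.1) (_he : v.asIdeal.ramificationIdx' w.1.asIdeal ≠ 1) (_h2 : ¬ IsUnit (2 : 𝒪[w.1.adicCompletion L]))
      (ϖ : (w.1.adicCompletion L)) (_hϖ : Valued.v ϖ = WithZero.exp (-1 : ℤ)), IsLocSmooth (g₁ L v w hw ϖ))
    (hs₂ : ∀ (L : Type) [Field L] [NumberField L] [IsCMField L] {v : HeightOneSpectrum (𝓞 ↥(maximalRealSubfield L))} (w : UnitaryGroup.PlacesOver L v)
      (hw : IsCMField.complexConj L • w.1 = w.1) (_he : v.asIdeal.ramificationIdx' w.1.asIdeal ≠ 1) (_h2 : ¬ IsUnit (2 : 𝒪[w.1.adicCompletion L]))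
      (ϖ : (w.1.adicCompletion L)) (_hϖ : Valued.v ϖ = WithZero.exp (-1 : ℤ)), IsLocSmooth (g₂ L v w hw ϖ))
    (a b : ℂ) (h₁ : PieceRowsWild (fun _ : Fin 1 => g₁) 0) (h₂ : PieceRowsWild (fun _ : Fin 1 => g₂) 0) :
    PieceRowsWild (fun _ : Fin 1 => fun (L : Type) [Field L] [NumberField L] [IsCMField L] (v : HeightOneSpectrum (𝓞 ↥(maximalRealSubfield L))) (w : UnitaryGroup.PlacesOver L v)
      (hw : IsCMField.complexConj L • w.1 = w.1) (ϖ : w.1.adicCompletion L) => a • g₁ L v w hw ϖ + b • g₂ L v w hw ϖ) 0 := by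
  intro L _ _ _ v w hw he h2 ϖ hϖ _ _ _ _ _ _ _ _ μ hμu hμω νH _ _ νG₃ _ _ mH mG₃ hmH hmG
  obtain ⟨r₁, ψ₁, hψ₁, a₁, h11, h12, h13⟩ := h₁ L w hw he h2 ϖ hϖ μ hμu hμω νH νG₃ mH mG₃ hmH hmG
  obtain ⟨r₂, ψ₂, hψ₂, a₂, h21, h22, h23⟩ := h₂ L w hw he h2 ϖ hϖ μ hμu hμω νH νG₃ mH mG₃ hmH hmG
  have hψ : ∀ s, IsLocSmooth (Fin.append ψ₁ ψ₂ s) := fun s => by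
    refine Fin.addCases (fun i => ?_) (fun i => ?_) s
    · rw [Fin.append_left]; exact hψ₁ i
    · rw [Fin.append_right]; exact hψ₂ i
  -- the G-side linearity at this place (canonical ⇒ admissible on the regular classes)
  have hlin := fun γH (hγ : IsLocalGRegular L v γH) =>
    finsum_delta_mul_classOrbitalIntegral_add_smul L
      ((finExplicitCollection L (Matrix.of fun i j : Fin 3 => if i.val + j.val + 1 = 3 then (1 : L) else 0) μ (finExplicitDelta_conj_left_all L (Matrix.of fun i j : Fin 3 => if i.val + j.val + 1 = 3 then (1 : L) else 0) μ) (finExplicitDelta_conj_right_all L (Matrix.of fun i j : Fin 3 => if i.val + j.val + 1 = 3 then (1 : L) else 0) μ)) v)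
      hmG.isAdmissibleOn a b (g₁ L v w hw ϖ) (g₂ L v w hw ϖ) (hs₁ L w hw he h2 ϖ hϖ) (hs₂ L w hw he h2 ϖ hϖ) γH hγ
  refine ⟨r₁ + r₂, Fin.append ψ₁ ψ₂, hψ, Fin.append (a • a₁) (b • a₂), ?_, ?_, ?_⟩
  · -- row (1): type (1) — a root in `L_w`, not `H_v`-conjugate to a diagonal element
    obtain ⟨V, hV, h⟩ := exists_nhds_rows_append (IsLocalGRegular L v)
      (fun γH => (∃ x : (w.1.adicCompletion L), (((((γH).1.val : GL (Fin 2) (UnitaryGroup.LocalRing L v)).val.map (Pi.evalRingHom (fun w' : UnitaryGroup.PlacesOver L v => w'.1.adicCompletion L) w))).charpoly).IsRoot x) ∧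
        ¬ (∃ (y : ((UnitaryGroup.cmDatum L 2 (Matrix.of fun i j : Fin 2 => if i.val + j.val + 1 = 2 then (1 : L) else 0)).Local v × (UnitaryGroup.cmDatum L 1 (Matrix.of fun i j : Fin 1 => if i.val + j.val + 1 = 1 then (1 : L) else 0)).Local v)) (d' : Fin 2 → (UnitaryGroup.LocalRing L v)ˣ),
            glDiagonal 2 (UnitaryGroup.LocalRing L v) d' = ((y * γH * y⁻¹).1.val : GL (Fin 2) (UnitaryGroup.LocalRing L v))))
      (fun ψ γH => stableOrbitalIntegralRel (IsLocalStablyConjH L v) mH ψ γH) ψ₁ ψ₂ a₁ a₂ a b _ _ _ hlin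
      (by obtain ⟨V, hV, h⟩ := h11; exact ⟨V, hV, fun x hx hr hP => h x hx hr hP.1 hP.2⟩)
      (by obtain ⟨V, hV, h⟩ := h21; exact ⟨V, hV, fun x hx hr hP => h x hx hr hP.1 hP.2⟩)
    exact ⟨V, hV, fun x hx hr hroot hnd => h x hx hr ⟨hroot, hnd⟩⟩
  · -- row (2): type (2) — no root in `L_w`
    exact exists_nhds_rows_append (IsLocalGRegular L v) _ (fun ψ γH => stableOrbitalIntegralRel (IsLocalStablyConjH L v) mH ψ γH) ψ₁ ψ₂ a₁ a₂ a b _ _ _ hlin h12 h22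
  · -- row (3): Levi — `H_v`-conjugate to a diagonal element
    exact exists_nhds_rows_append (IsLocalGRegular L v) _ (fun ψ γH => stableOrbitalIntegralRel (IsLocalStablyConjH L v) mH ψ γH) ψ₁ ψ₂ a₁ a₂ a b _ _ _ hlin h13 h23

/-- **ROWS TRANSPORT ALONG POINTWISE EQUALITY OF PIECES** (at every wild place datum): if `g' = g` as functions on `G′_v` for every `(L, w, ϖ)` behind the place binders,
then `rows(g) ⇒ rows(g')`. [cite: Rogawski1990, §4.9 Prop. 4.9.1 (a) p. 55] -/
theorem pieceRowsWild_congr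
    (g g' : (∀ (L : Type) [Field L] [NumberField L] [IsCMField L] (v : HeightOneSpectrum (𝓞 ↥(maximalRealSubfield L))) (w : UnitaryGroup.PlacesOver L v), IsCMField.complexConj L • w.1 = w.1 → w.1.adicCompletion L → ((UnitaryGroup.cmDatum L 3 (Matrix.of fun i j : Fin 3 => if i.val + j.val + 1 = 3 then (1 : L) else 0)).Local v) → ℂ))
    (heq : ∀ (L : Type) [Field L] [NumberField L] [IsCMField L] {v : HeightOneSpectrum (𝓞 ↥(maximalRealSubfield L))} (w : UnitaryGroup.PlacesOver L v)
      (hw : IsCMField.complexConj L • w.1 = w.1) (_he : v.asIdeal.ramificationIdx' w.1.asIdeal ≠ 1) (_h2 : ¬ IsUnit (2 : 𝒪[w.1.adicCompletion L]))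
      (ϖ : (w.1.adicCompletion L)) (_hϖ : Valued.v ϖ = WithZero.exp (-1 : ℤ)), g' L v w hw ϖ = g L v w hw ϖ)
    (h : PieceRowsWild (fun _ : Fin 1 => g) 0) : PieceRowsWild (fun _ : Fin 1 => g') 0 := by
  intro L _ _ _ v w hw he h2 ϖ hϖ _ _ _ _ _ _ _ _ μ hμu hμω νH _ _ νG₃ _ _ mH mG₃ hmH hmG
  have e : (fun _ : Fin 1 => g') 0 L v w hw ϖ = (fun _ : Fin 1 => g) 0 L v w hw ϖ := heq L w hw he h2 ϖ hϖ
  rw [e]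
  exact h L w hw he h2 ϖ hϖ μ hμu hμω νH νG₃ mH mG₃ hmH hmG

/-- `rows(g₁) ∧ rows(g₂) ⇒ rows(g₁ − g₂)` for smooth pieces (the case `a = 1`, `b = −1` of `pieceRowsWild_add_smul`). [cite: Rogawski1990, §4.3 (4.3.1) p. 43] -/
theorem pieceRowsWild_sub
    (g₁ g₂ : (∀ (L : Type) [Field L] [NumberField L] [IsCMField L] (v : HeightOneSpectrum (𝓞 ↥(maximalRealSubfield L))) (w : UnitaryGroup.PlacesOver L v), IsCMField.complexConj L • w.1 = w.1 → w.1.adicCompletion L → ((UnitaryGroup.cmDatum L 3 (Matrix.of fun i j : Fin 3 => if i.val + j.val + 1 = 3 then (1 : L) else 0)).Local v) → ℂ))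
    (hs₁ : ∀ (L : Type) [Field L] [NumberField L] [IsCMField L] {v : HeightOneSpectrum (𝓞 ↥(maximalRealSubfield L))} (w : UnitaryGroup.PlacesOver L v)
      (hw : IsCMField.complexConj L • w.1 = w.1) (_he : v.asIdeal.ramificationIdx' w.1.asIdeal ≠ 1) (_h2 : ¬ IsUnit (2 : 𝒪[w.1.adicCompletion L]))
      (ϖ : (w.1.adicCompletion L)) (_hϖ : Valued.v ϖ = WithZero.exp (-1 : ℤ)), IsLocSmooth (g₁ L v w hw ϖ))
    (hs₂ : ∀ (L : Type) [Field L] [NumberField L] [IsCMField L] {v : HeightOneSpectrum (𝓞 ↥(maximalRealSubfield L))} (w : UnitaryGroup.PlacesOver L v)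
      (hw : IsCMField.complexConj L • w.1 = w.1) (_he : v.asIdeal.ramificationIdx' w.1.asIdeal ≠ 1) (_h2 : ¬ IsUnit (2 : 𝒪[w.1.adicCompletion L]))
      (ϖ : (w.1.adicCompletion L)) (_hϖ : Valued.v ϖ = WithZero.exp (-1 : ℤ)), IsLocSmooth (g₂ L v w hw ϖ))
    (h₁ : PieceRowsWild (fun _ : Fin 1 => g₁) 0) (h₂ : PieceRowsWild (fun _ : Fin 1 => g₂) 0) :
    PieceRowsWild (fun _ : Fin 1 => fun (L : Type) [Field L] [NumberField L] [IsCMField L] (v : HeightOneSpectrum (𝓞 ↥(maximalRealSubfield L))) (w : UnitaryGroup.PlacesOver L v)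
      (hw : IsCMField.complexConj L • w.1 = w.1) (ϖ : w.1.adicCompletion L) => g₁ L v w hw ϖ - g₂ L v w hw ϖ) 0 := by
  refine pieceRowsWild_congr _ _ (fun L _ _ _ v w hw _ _ ϖ _ => ?_) (pieceRowsWild_add_smul g₁ g₂ hs₁ hs₂ 1 (-1) h₁ h₂)
  simp only [one_smul, neg_smul, ← sub_eq_add_neg]

/-! ## §4  The pointwise identities among the explicit pieces -/

section Pointwise

variable (L : Type) [Field L] [NumberField L] [IsCMField L] {v : HeightOneSpectrum (𝓞 ↥(maximalRealSubfield L))}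
  (w : UnitaryGroup.PlacesOver L v) (hw : IsCMField.complexConj L • w.1 = w.1)

/-- **`f_{T−} = 𝟙_{shell} − f_{T+}`**: on the near-transvection shell inside `K` exactly one of the two labels holds; off it all three vanish (`X := wMatrix u − 1`).
[cite: Rogawski1990, §4.9 Prop. 4.9.1 (a) p. 55] [cite: Kottwitz1986BaseChangeUnits, §3] -/
theorem pieceTransvMinus_eq_shell_sub (ϖ : w.1.adicCompletion L) :
    pieceTransvMinus L v w hw ϖ =
      Set.indicator {u : ((UnitaryGroup.cmDatum L 3 (Matrix.of fun i j : Fin 3 => if i.val + j.val + 1 = 3 then (1 : L) else 0)).Local v) |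
          u ∈ cmLocalIntegralLevel L 3 (Matrix.of fun i j : Fin 3 => if i.val + j.val + 1 = 3 then (1 : L) else 0) v ∧
          NearTransvShell ϖ (dOfPlace L v w % 2) (mstarFn L v w) (wMatrix L w hw u - 1)} (fun _ => (1 : ℂ)) -
        pieceTransvPlus L v w hw ϖ := by
  funext u
  simp only [pieceTransvMinus, pieceTransvPlus, Pi.sub_apply, Set.indicator, Set.mem_setOf_eq]
  by_cases hK : u ∈ cmLocalIntegralLevel L 3 (Matrix.of fun i j : Fin 3 => if i.val + j.val + 1 = 3 then (1 : L) else 0) v ∧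
      NearTransvShell ϖ (dOfPlace L v w % 2) (mstarFn L v w) (wMatrix L w hw u - 1)
  · by_cases hP : LabelPlus (galAdicCompletionMap (L := L) (IsCMField.complexConj L) hw) ϖ (dOfPlace L v w) (mstarFn L v w) (wMatrix L w hw u - 1)
    · rw [if_neg (fun h => h.2.2 hP), if_pos hK, if_pos ⟨hK.1, hK.2, hP⟩, sub_self]
    · rw [if_pos ⟨hK.1, hK.2, hP⟩, if_pos hK, if_neg (fun h => hP h.2.2), sub_zero]
  · rw [if_neg (fun h => hK ⟨h.1, h.2.1⟩), if_neg hK, if_neg (fun h => hK ⟨h.1, h.2.1⟩), sub_zero]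

/-- **`𝟙_{shell} = 𝟙_{K_{ℓ₀,m*}} − 𝟙_{K_{ℓ₀+1,m*}}`** with `K_{a,b} := {u ∈ K ∣ X ∈ ϖ^a M₃(𝒪_w), X² ∈ ϖ^b M₃(𝒪_w)}`: the shell `X ∈ ϖ^{ℓ₀}M₃ ∖ ϖ^{ℓ₀+1}M₃, X² ∈ ϖ^{m*}M₃` is the
difference of two nested congruence-profile sets (`|ϖ| ≤ 1`: `InLevel (ℓ₀+1) ⇒ InLevel ℓ₀`, ★ `inLevel_of_le`). [cite: Kottwitz1986BaseChangeUnits, §1 pp. 240–241] -/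
theorem shell_eq_levels_sub {ϖ : w.1.adicCompletion L} (hϖ : Valued.v ϖ = WithZero.exp (-1 : ℤ)) (ℓ m : ℕ) :
    Set.indicator {u : ((UnitaryGroup.cmDatum L 3 (Matrix.of fun i j : Fin 3 => if i.val + j.val + 1 = 3 then (1 : L) else 0)).Local v) |
          u ∈ cmLocalIntegralLevel L 3 (Matrix.of fun i j : Fin 3 => if i.val + j.val + 1 = 3 then (1 : L) else 0) v ∧
          NearTransvShell ϖ ℓ m (wMatrix L w hw u - 1)} (fun _ => (1 : ℂ)) =
      Set.indicator {u : ((UnitaryGroup.cmDatum L 3 (Matrix.of fun i j : Fin 3 => if i.val + j.val + 1 = 3 then (1 : L) else 0)).Local v) |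
          u ∈ cmLocalIntegralLevel L 3 (Matrix.of fun i j : Fin 3 => if i.val + j.val + 1 = 3 then (1 : L) else 0) v ∧
          (InLevel ϖ ℓ (wMatrix L w hw u - 1) ∧ InLevel ϖ m ((wMatrix L w hw u - 1) * (wMatrix L w hw u - 1)))} (fun _ => (1 : ℂ)) -
      Set.indicator {u : ((UnitaryGroup.cmDatum L 3 (Matrix.of fun i j : Fin 3 => if i.val + j.val + 1 = 3 then (1 : L) else 0)).Local v) |
          u ∈ cmLocalIntegralLevel L 3 (Matrix.of fun i j : Fin 3 => if i.val + j.val + 1 = 3 then (1 : L) else 0) v ∧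
          (InLevel ϖ (ℓ + 1) (wMatrix L w hw u - 1) ∧ InLevel ϖ m ((wMatrix L w hw u - 1) * (wMatrix L w hw u - 1)))} (fun _ => (1 : ℂ)) := by
  obtain ⟨hϖ0, -, hϖ1⟩ := uniformizer_facts L w hϖ
  funext u
  simp only [Pi.sub_apply, Set.indicator, Set.mem_setOf_eq, NearTransvShell]
  by_cases hK : u ∈ cmLocalIntegralLevel L 3 (Matrix.of fun i j : Fin 3 => if i.val + j.val + 1 = 3 then (1 : L) else 0) v
  · by_cases hm : InLevel ϖ m ((wMatrix L w hw u - 1) * (wMatrix L w hw u - 1))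
    · by_cases h1 : InLevel ϖ (ℓ + 1) (wMatrix L w hw u - 1)
      · have h0 : InLevel ϖ ℓ (wMatrix L w hw u - 1) := inLevel_of_le hϖ0 hϖ1 (Nat.le_succ ℓ) h1
        rw [if_neg (fun h => h.2.2.1 h1), if_pos ⟨hK, h0, hm⟩, if_pos ⟨hK, h1, hm⟩, sub_self]
      · by_cases h0 : InLevel ϖ ℓ (wMatrix L w hw u - 1)
        · rw [if_pos ⟨hK, h0, h1, hm⟩, if_pos ⟨hK, h0, hm⟩, if_neg (fun h => h1 h.2.1), sub_zero]
        · rw [if_neg (fun h => h0 h.2.1), if_neg (fun h => h0 h.2.1), if_neg (fun h => h1 h.2.1), sub_zero]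
    · rw [if_neg (fun h => hm h.2.2.2), if_neg (fun h => hm h.2.2), if_neg (fun h => hm h.2.2), sub_zero]
  · rw [if_neg (fun h => hK h.1), if_neg (fun h => hK h.1), if_neg (fun h => hK h.1), sub_zero]

/-- **`f_reg = 1_K − 𝟙{u ∈ K ∣ X² ∈ ϖ^{m*}M₃(𝒪_w)}`** (`X := wMatrix u − 1`). [cite: Rogawski1990, §4.9 Prop. 4.9.1 (a) p. 55] [cite: Kottwitz1986BaseChangeUnits, §3] -/
theorem pieceReg_eq_unit0_sub (ϖ : w.1.adicCompletion L) :
    pieceReg L v w hw ϖ =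
      pieceUnit0 L v w hw ϖ -
        Set.indicator {u : ((UnitaryGroup.cmDatum L 3 (Matrix.of fun i j : Fin 3 => if i.val + j.val + 1 = 3 then (1 : L) else 0)).Local v) |
          u ∈ cmLocalIntegralLevel L 3 (Matrix.of fun i j : Fin 3 => if i.val + j.val + 1 = 3 then (1 : L) else 0) v ∧
          InLevel ϖ (mstarFn L v w) ((wMatrix L w hw u - 1) * (wMatrix L w hw u - 1))} (fun _ => (1 : ℂ)) := by
  funext u
  simp only [pieceReg, pieceUnit0, Pi.sub_apply, Set.indicator, Set.mem_setOf_eq, SetLike.mem_coe]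
  by_cases hK : u ∈ cmLocalIntegralLevel L 3 (Matrix.of fun i j : Fin 3 => if i.val + j.val + 1 = 3 then (1 : L) else 0) v
  · by_cases hm : InLevel ϖ (mstarFn L v w) ((wMatrix L w hw u - 1) * (wMatrix L w hw u - 1))
    · rw [if_neg (fun h => h.2 hm), if_pos hK, if_pos ⟨hK, hm⟩, sub_self]
    · rw [if_pos ⟨hK, hm⟩, if_pos hK, if_neg (fun h => hm h.2), sub_zero]
  · rw [if_neg (fun h => hK h.1), if_neg hK, if_neg (fun h => hK h.1), sub_zero]

include hw in
/-- **THE CONGRUENCE-PROFILE PIECE `𝟙_{K_{a,b}}` IS `C_c^∞` WITH `tsupport ⊆ K`** for `b ≤ mstarFn + 2` and `a ≤ mstarFn + 2` (a level class function at level `mstarFn + 2`,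
★ `isLocSmooth_indicator_profile` with ★ `inLevel_add_iff_of_inLevel` + ★ `inLevel_mul_self_add_iff`). [cite: BernsteinZelevinsky1976, §1.1] [cite: Kottwitz1986BaseChangeUnits, §1 pp. 240–241] -/
theorem isLocSmooth_levelsPiece {ϖ : w.1.adicCompletion L} (hϖ : Valued.v ϖ = WithZero.exp (-1 : ℤ)) {a b : ℕ} (ha : a ≤ mstarFn L v w + 2) (hb : b ≤ mstarFn L v w + 2) :
    IsLocSmooth (Set.indicator {u : ((UnitaryGroup.cmDatum L 3 (Matrix.of fun i j : Fin 3 => if i.val + j.val + 1 = 3 then (1 : L) else 0)).Local v) |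
          u ∈ cmLocalIntegralLevel L 3 (Matrix.of fun i j : Fin 3 => if i.val + j.val + 1 = 3 then (1 : L) else 0) v ∧
          (InLevel ϖ a (wMatrix L w hw u - 1) ∧ InLevel ϖ b ((wMatrix L w hw u - 1) * (wMatrix L w hw u - 1)))} (fun _ => (1 : ℂ))) ∧
      tsupport (Set.indicator {u : ((UnitaryGroup.cmDatum L 3 (Matrix.of fun i j : Fin 3 => if i.val + j.val + 1 = 3 then (1 : L) else 0)).Local v) |
          u ∈ cmLocalIntegralLevel L 3 (Matrix.of fun i j : Fin 3 => if i.val + j.val + 1 = 3 then (1 : L) else 0) v ∧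
          (InLevel ϖ a (wMatrix L w hw u - 1) ∧ InLevel ϖ b ((wMatrix L w hw u - 1) * (wMatrix L w hw u - 1)))} (fun _ => (1 : ℂ))) ⊆
        (cmLocalIntegralLevel L 3 (Matrix.of fun i j : Fin 3 => if i.val + j.val + 1 = 3 then (1 : L) else 0) v : Set ((UnitaryGroup.cmDatum L 3 (Matrix.of fun i j : Fin 3 => if i.val + j.val + 1 = 3 then (1 : L) else 0)).Local v)) := by
  obtain ⟨hϖ0, hϖ1, hϖ1'⟩ := uniformizer_facts L w hϖ
  simp only [wMatrix]
  exact isLocSmooth_indicator_profile L w hw (fun X => InLevel ϖ a X ∧ InLevel ϖ b (X * X)) hϖ0 hϖ1 (show 1 ≤ mstarFn L v w + 2 by omega)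
    (fun X D hX hD => and_congr (inLevel_add_iff_of_inLevel hϖ0 hϖ1' ha hD) (inLevel_mul_self_add_iff hϖ0 hϖ1' hb hX hD))

end Pointwise

/-! ## §5  The derived tier-0 rows -/

/-- **ROW `transvMinus` FROM ROW `transvPlus` AND THE SHELL ROW**: `PieceRowsWild gselStar 2 ⇐ PieceRowsWild gselStar 1 ∧ rows(𝟙_{shell})` (`f_{T−} = 𝟙_{shell} − f_{T+}`, §3–§4;
the shell piece is smooth as `f_{T+} + f_{T−}`). [cite: Rogawski1990, §4.9 Prop. 4.9.1 (a) pp. 54–55; §4.3 (4.3.1) p. 43] -/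
theorem pieceRowsWild_gselStar_two_of (hPlus : PieceRowsWild gselStar 1)
    (hShell : PieceRowsWild (fun _ : Fin 1 => fun (L : Type) [Field L] [NumberField L] [IsCMField L] (v : HeightOneSpectrum (𝓞 ↥(maximalRealSubfield L))) (w : UnitaryGroup.PlacesOver L v)
      (hw : IsCMField.complexConj L • w.1 = w.1) (ϖ : w.1.adicCompletion L) =>
      Set.indicator {u : ((UnitaryGroup.cmDatum L 3 (Matrix.of fun i j : Fin 3 => if i.val + j.val + 1 = 3 then (1 : L) else 0)).Local v) |
          u ∈ cmLocalIntegralLevel L 3 (Matrix.of fun i j : Fin 3 => if i.val + j.val + 1 = 3 then (1 : L) else 0) v ∧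
          NearTransvShell ϖ (dOfPlace L v w % 2) (mstarFn L v w) (wMatrix L w hw u - 1)} (fun _ => (1 : ℂ))) 0) :
    PieceRowsWild gselStar 2 := by
  have hsP : ∀ (L : Type) [Field L] [NumberField L] [IsCMField L] {v : HeightOneSpectrum (𝓞 ↥(maximalRealSubfield L))} (w : UnitaryGroup.PlacesOver L v)
      (hw : IsCMField.complexConj L • w.1 = w.1) (_he : v.asIdeal.ramificationIdx' w.1.asIdeal ≠ 1) (_h2 : ¬ IsUnit (2 : 𝒪[w.1.adicCompletion L]))
      (ϖ : (w.1.adicCompletion L)) (_hϖ : Valued.v ϖ = WithZero.exp (-1 : ℤ)), IsLocSmooth (pieceTransvPlus L v w hw ϖ) :=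
    fun L _ _ _ v w hw _ _ ϖ hϖ => (isLocSmooth_pieceTransvPlus L w hw hϖ).1
  have hsS : ∀ (L : Type) [Field L] [NumberField L] [IsCMField L] {v : HeightOneSpectrum (𝓞 ↥(maximalRealSubfield L))} (w : UnitaryGroup.PlacesOver L v)
      (hw : IsCMField.complexConj L • w.1 = w.1) (_he : v.asIdeal.ramificationIdx' w.1.asIdeal ≠ 1) (_h2 : ¬ IsUnit (2 : 𝒪[w.1.adicCompletion L]))
      (ϖ : (w.1.adicCompletion L)) (_hϖ : Valued.v ϖ = WithZero.exp (-1 : ℤ)),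
      IsLocSmooth (Set.indicator {u : ((UnitaryGroup.cmDatum L 3 (Matrix.of fun i j : Fin 3 => if i.val + j.val + 1 = 3 then (1 : L) else 0)).Local v) |
          u ∈ cmLocalIntegralLevel L 3 (Matrix.of fun i j : Fin 3 => if i.val + j.val + 1 = 3 then (1 : L) else 0) v ∧
          NearTransvShell ϖ (dOfPlace L v w % 2) (mstarFn L v w) (wMatrix L w hw u - 1)} (fun _ => (1 : ℂ))) := by
    intro L _ _ _ v w hw _ _ ϖ hϖ
    have e := pieceTransvMinus_eq_shell_sub L w hw ϖ
    rw [eq_sub_iff_add_eq] at e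
    rw [← e]
    exact (isLocSmooth_pieceTransvMinus L w hw hϖ).1.add (isLocSmooth_pieceTransvPlus L w hw hϖ).1
  exact pieceRowsWild_congr _ _ (fun L _ _ _ v w hw _ _ ϖ _ => pieceTransvMinus_eq_shell_sub L w hw ϖ) (pieceRowsWild_sub _ _ hsS hsP hShell hPlus)

/-- **THE SHELL ROW FROM TWO CONGRUENCE-PROFILE ROWS**: `rows(𝟙_{shell}) ⇐ rows(𝟙_{K_{ℓ₀,m*}}) ∧ rows(𝟙_{K_{ℓ₀+1,m*}})` (§4 `shell_eq_levels_sub`, `isLocSmooth_levelsPiece`).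
[cite: Rogawski1990, §4.9 Prop. 4.9.1 (a) pp. 54–55] [cite: Kottwitz1986BaseChangeUnits, §1 pp. 240–241] -/
theorem pieceRowsWild_shell_of_levels
    (hA : PieceRowsWild (fun _ : Fin 1 => fun (L : Type) [Field L] [NumberField L] [IsCMField L] (v : HeightOneSpectrum (𝓞 ↥(maximalRealSubfield L))) (w : UnitaryGroup.PlacesOver L v)
      (hw : IsCMField.complexConj L • w.1 = w.1) (ϖ : w.1.adicCompletion L) =>
      Set.indicator {u : ((UnitaryGroup.cmDatum L 3 (Matrix.of fun i j : Fin 3 => if i.val + j.val + 1 = 3 then (1 : L) else 0)).Local v) |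
          u ∈ cmLocalIntegralLevel L 3 (Matrix.of fun i j : Fin 3 => if i.val + j.val + 1 = 3 then (1 : L) else 0) v ∧
          (InLevel ϖ (dOfPlace L v w % 2) (wMatrix L w hw u - 1) ∧ InLevel ϖ (mstarFn L v w) ((wMatrix L w hw u - 1) * (wMatrix L w hw u - 1)))} (fun _ => (1 : ℂ))) 0)
    (hB : PieceRowsWild (fun _ : Fin 1 => fun (L : Type) [Field L] [NumberField L] [IsCMField L] (v : HeightOneSpectrum (𝓞 ↥(maximalRealSubfield L))) (w : UnitaryGroup.PlacesOver L v)
      (hw : IsCMField.complexConj L • w.1 = w.1) (ϖ : w.1.adicCompletion L) =>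
      Set.indicator {u : ((UnitaryGroup.cmDatum L 3 (Matrix.of fun i j : Fin 3 => if i.val + j.val + 1 = 3 then (1 : L) else 0)).Local v) |
          u ∈ cmLocalIntegralLevel L 3 (Matrix.of fun i j : Fin 3 => if i.val + j.val + 1 = 3 then (1 : L) else 0) v ∧
          (InLevel ϖ (dOfPlace L v w % 2 + 1) (wMatrix L w hw u - 1) ∧ InLevel ϖ (mstarFn L v w) ((wMatrix L w hw u - 1) * (wMatrix L w hw u - 1)))} (fun _ => (1 : ℂ))) 0) :
    PieceRowsWild (fun _ : Fin 1 => fun (L : Type) [Field L] [NumberField L] [IsCMField L] (v : HeightOneSpectrum (𝓞 ↥(maximalRealSubfield L))) (w : UnitaryGroup.PlacesOver L v)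
      (hw : IsCMField.complexConj L • w.1 = w.1) (ϖ : w.1.adicCompletion L) =>
      Set.indicator {u : ((UnitaryGroup.cmDatum L 3 (Matrix.of fun i j : Fin 3 => if i.val + j.val + 1 = 3 then (1 : L) else 0)).Local v) |
          u ∈ cmLocalIntegralLevel L 3 (Matrix.of fun i j : Fin 3 => if i.val + j.val + 1 = 3 then (1 : L) else 0) v ∧
          NearTransvShell ϖ (dOfPlace L v w % 2) (mstarFn L v w) (wMatrix L w hw u - 1)} (fun _ => (1 : ℂ))) 0 := by
  have hmod : ∀ (L : Type) [Field L] [NumberField L] [IsCMField L] (v : HeightOneSpectrum (𝓞 ↥(maximalRealSubfield L))) (w : UnitaryGroup.PlacesOver L v),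
      dOfPlace L v w % 2 + 1 ≤ mstarFn L v w + 2 := fun L _ _ _ v w => by have := Nat.mod_lt (dOfPlace L v w) (show 0 < 2 by norm_num); omega
  refine pieceRowsWild_congr _ _ (fun L _ _ _ v w hw _ _ ϖ hϖ => shell_eq_levels_sub L w hw hϖ _ _) (pieceRowsWild_sub _ _ ?_ ?_ hA hB)
  · exact fun L _ _ _ v w hw _ _ ϖ hϖ => (isLocSmooth_levelsPiece L w hw hϖ ((Nat.le_succ _).trans (hmod L v w)) (Nat.le_add_right _ 2)).1
  · exact fun L _ _ _ v w hw _ _ ϖ hϖ => (isLocSmooth_levelsPiece L w hw hϖ (hmod L v w) (Nat.le_add_right _ 2)).1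

/-- **ROW `regular` FROM ROW `unit0` AND THE SQUARE-LEVEL ROW**: `PieceRowsWild gselStar 3 ⇐ PieceRowsWild gselStar 0 ∧ rows(𝟙{u ∈ K ∣ X² ∈ ϖ^{m*}M₃})` (`f_reg = 1_K − 𝟙{…}`,
§3–§4). [cite: Rogawski1990, §4.9 Prop. 4.9.1 (a) pp. 54–55; §4.3 (4.3.1) p. 43] -/
theorem pieceRowsWild_gselStar_three_of (hUnit : PieceRowsWild gselStar 0)
    (hSq : PieceRowsWild (fun _ : Fin 1 => fun (L : Type) [Field L] [NumberField L] [IsCMField L] (v : HeightOneSpectrum (𝓞 ↥(maximalRealSubfield L))) (w : UnitaryGroup.PlacesOver L v)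
      (hw : IsCMField.complexConj L • w.1 = w.1) (ϖ : w.1.adicCompletion L) =>
      Set.indicator {u : ((UnitaryGroup.cmDatum L 3 (Matrix.of fun i j : Fin 3 => if i.val + j.val + 1 = 3 then (1 : L) else 0)).Local v) |
          u ∈ cmLocalIntegralLevel L 3 (Matrix.of fun i j : Fin 3 => if i.val + j.val + 1 = 3 then (1 : L) else 0) v ∧
          InLevel ϖ (mstarFn L v w) ((wMatrix L w hw u - 1) * (wMatrix L w hw u - 1))} (fun _ => (1 : ℂ))) 0) :
    PieceRowsWild gselStar 3 := by
  have hsU : ∀ (L : Type) [Field L] [NumberField L] [IsCMField L] {v : HeightOneSpectrum (𝓞 ↥(maximalRealSubfield L))} (w : UnitaryGroup.PlacesOver L v)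
      (hw : IsCMField.complexConj L • w.1 = w.1) (_he : v.asIdeal.ramificationIdx' w.1.asIdeal ≠ 1) (_h2 : ¬ IsUnit (2 : 𝒪[w.1.adicCompletion L]))
      (ϖ : (w.1.adicCompletion L)) (_hϖ : Valued.v ϖ = WithZero.exp (-1 : ℤ)), IsLocSmooth (pieceUnit0 L v w hw ϖ) :=
    fun L _ _ _ v w hw _ _ ϖ _ => isLocSmooth_indicator_cmLocalIntegralLevel L 3 (Matrix.of fun i j : Fin 3 => if i.val + j.val + 1 = 3 then (1 : L) else 0) v
  have hsQ : ∀ (L : Type) [Field L] [NumberField L] [IsCMField L] {v : HeightOneSpectrum (𝓞 ↥(maximalRealSubfield L))} (w : UnitaryGroup.PlacesOver L v)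
      (hw : IsCMField.complexConj L • w.1 = w.1) (_he : v.asIdeal.ramificationIdx' w.1.asIdeal ≠ 1) (_h2 : ¬ IsUnit (2 : 𝒪[w.1.adicCompletion L]))
      (ϖ : (w.1.adicCompletion L)) (_hϖ : Valued.v ϖ = WithZero.exp (-1 : ℤ)),
      IsLocSmooth (Set.indicator {u : ((UnitaryGroup.cmDatum L 3 (Matrix.of fun i j : Fin 3 => if i.val + j.val + 1 = 3 then (1 : L) else 0)).Local v) |
          u ∈ cmLocalIntegralLevel L 3 (Matrix.of fun i j : Fin 3 => if i.val + j.val + 1 = 3 then (1 : L) else 0) v ∧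
          InLevel ϖ (mstarFn L v w) ((wMatrix L w hw u - 1) * (wMatrix L w hw u - 1))} (fun _ => (1 : ℂ))) := by
    intro L _ _ _ v w hw _ _ ϖ hϖ
    have e : Set.indicator {u : ((UnitaryGroup.cmDatum L 3 (Matrix.of fun i j : Fin 3 => if i.val + j.val + 1 = 3 then (1 : L) else 0)).Local v) |
          u ∈ cmLocalIntegralLevel L 3 (Matrix.of fun i j : Fin 3 => if i.val + j.val + 1 = 3 then (1 : L) else 0) v ∧
          InLevel ϖ (mstarFn L v w) ((wMatrix L w hw u - 1) * (wMatrix L w hw u - 1))} (fun _ => (1 : ℂ)) =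
        pieceUnit0 L v w hw ϖ - pieceReg L v w hw ϖ := by
      rw [pieceReg_eq_unit0_sub L w hw ϖ, sub_sub_cancel]
    rw [e]
    exact (isLocSmooth_indicator_cmLocalIntegralLevel L 3 (Matrix.of fun i j : Fin 3 => if i.val + j.val + 1 = 3 then (1 : L) else 0) v).sub
      (isLocSmooth_pieceReg L w hw hϖ).1
  exact pieceRowsWild_congr _ _ (fun L _ _ _ v w hw _ _ ϖ _ => pieceReg_eq_unit0_sub L w hw ϖ) (pieceRowsWild_sub _ _ hsU hsQ hUnit hSq)

end Summit.HodgeConjecture.HodgeConjecture.Cruxes.H413.F0P3cDyRamPieceRowsWildLinear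

end
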